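import Literature.NumberTheory.Automorphic.GL2CuspSeparation
import Literature.NumberTheory.Automorphic.AdelicVectorHeightCompact
import Literature.NumberTheory.Automorphic.RatPointsCoveringWeights
import Literature.NumberTheory.Automorphic.IwasawaHaarGL2
import Literature.NumberTheory.Automorphic.GL2ParabolicClasses
import Literature.NumberTheory.Automorphic.IdeleNormDetGL
import HarnessLib

/-!
# The cusp parameter `𝔥(y) = h(e₂ y⁻¹)² / |det y⁻¹|_𝔸` on `GL₂(𝔸_K)` (Gelbart's `e^{-2H(x)}`
# for `x = y⁻¹`) and Lemma 9.8 in the tree's right-quotient conventions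
(Gelbart, *Automorphic forms on adele groups* (1975), (8.8)–(8.9) and Lemma 9.8)

Topic `NumberTheory/Automorphic`; one definition with body (`cuspParamGL2`) and theorems. Gelbart
measures the position of `x = n a h_t k ∈ GL₂(𝔸)` relative to the cusp by `H(x)` ((8.8)–(8.9)),
a function on `N_𝔸 A_ℚ \ G_𝔸 / K`. The automorphic quotient of the tree is the RIGHT coset space
`G(𝔸) ⧸ A_G GL₂(K)` (`x̃ = x⁻¹`), so the relevant function is `y ↦ e^{-2H(y⁻¹)}`, with the
intrinsic expression

  `𝔥(y) = h(e₂ y⁻¹)² / |det y⁻¹|_𝔸`,  `h` = the adelic height of row vectors (`vecHeight`),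

small exactly when `y` is high in the cusp. We prove `𝔥(k d(a₁,a₂) u) = |a₁/a₂|_𝔸` in the
Iwasawa coordinates `K · A · N` of `IwasawaHaarGL2KAN` (`cuspParamGL2_kan`); right invariance under
the rational Borel subgroup `ι(B(K))` (`cuspParamGL2_mul_map_of_mem_borel`) and under `A_G`
(`cuspParamGL2_mul_posRealScalar`), left invariance under `K` (`cuspParamGL2_compact_mul`) — so
that the cut-off `χ̃_ε = 1_{𝔥 < ε⁻²}` of the parabolic terms lives on `K \ G(𝔸) / A_G B(K)` — and
**Lemma 9.8 (separation of cusps, sharp form)**: `1 ≤ 𝔥(y ι(γ)) · 𝔥(y)` for every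
`γ ∈ GL₂(K) ∖ B(K)` (`one_le_cuspParamGL2_mul_map_mul`, from the Hadamard inequality of
`GL2CuspSeparation`): a rational element outside the Borel subgroup never keeps a point of the
cusp `{𝔥 < 1}` inside it.

## References

* S. Gelbart, *Automorphic forms on adele groups*, Ann. of Math. Studies 83 (1975), (8.8)–(8.9),
  Lemma 9.8 [Gelbart1975].
-/

noncomputable section

open scoped NNReal Matrix MatrixGroups
open NumberField IsDedekindDomain

namespace Literature.NumberTheory.Automorphic

variable (K : Type) [Field K] [NumberField K]

/-- **The cusp parameter** `𝔥(y) = h(e₂ y⁻¹)² / |det y⁻¹|_𝔸` of `y ∈ GL₂(𝔸_K)` (Gelbart's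
`e^{-2 H(y⁻¹)}`). [cite: Gelbart1975, (8.8)–(8.9)] -/
def cuspParamGL2 (y : GL (Fin 2) (AdeleRing (𝓞 K) K)) : ℝ≥0 :=
  vecHeight K (Pi.single (1 : Fin 2) (1 : AdeleRing (𝓞 K) K) ᵥ*
      ((y⁻¹ : GL (Fin 2) (AdeleRing (𝓞 K) K)) : Matrix (Fin 2) (Fin 2) (AdeleRing (𝓞 K) K))) ^ 2 /
    IdeleClassGroup.ideleNorm K (Matrix.GeneralLinearGroup.det y⁻¹)

/-- Unfolding of `cuspParamGL2`. [folklore] -/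
theorem cuspParamGL2_apply (y : GL (Fin 2) (AdeleRing (𝓞 K) K)) :
    cuspParamGL2 K y = vecHeight K (Pi.single (1 : Fin 2) (1 : AdeleRing (𝓞 K) K) ᵥ*
      ((y⁻¹ : GL (Fin 2) (AdeleRing (𝓞 K) K)) : Matrix (Fin 2) (Fin 2) (AdeleRing (𝓞 K) K))) ^ 2 /
    IdeleClassGroup.ideleNorm K (Matrix.GeneralLinearGroup.det y⁻¹) := rfl

/-! ### `e₂` through upper triangular matrices; finiteness of heights -/

/-- `e₂ M = M₁₁ e₂` for a `2 × 2` matrix with `M₁₀ = 0`. [folklore] -/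
theorem single_one_vecMul_of_apply_one_zero {R : Type*} [CommRing R] {M : Matrix (Fin 2) (Fin 2) R}
    (h : M 1 0 = 0) : Pi.single (1 : Fin 2) (1 : R) ᵥ* M = Pi.single (1 : Fin 2) (M 1 1) := by
  funext j
  rw [Matrix.single_one_vecMul, Matrix.row_apply]
  fin_cases j
  · simp [h]
  · simp

/-- `e₂ = principalVec e₂`. [folklore] -/
theorem principalVec_single_one :
    principalVec K (Pi.single (1 : Fin 2) (1 : K)) = Pi.single (1 : Fin 2) (1 : AdeleRing (𝓞 K) K) := by
  funext j
  rw [principalVec_apply]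
  fin_cases j <;> simp

/-- `principalVec` commutes with rational matrices (the `2 × 2` case of
`principalVec_vecMul_map`). [folklore] -/
theorem principalVec_vecMul_map_two (ξ : Fin 2 → K) (γ : GL (Fin 2) K) :
    principalVec K ξ ᵥ* ((Matrix.GeneralLinearGroup.map (algebraMap K (AdeleRing (𝓞 K) K)) γ :
        GL (Fin 2) (AdeleRing (𝓞 K) K)) : Matrix (Fin 2) (Fin 2) (AdeleRing (𝓞 K) K)) =
      principalVec K (ξ ᵥ* (γ : Matrix (Fin 2) (Fin 2) K)) := by
  funext i
  change ((algebraMap K (AdeleRing (𝓞 K) K) ∘ ξ) ᵥ* (γ : Matrix (Fin 2) (Fin 2) K).map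
    (algebraMap K (AdeleRing (𝓞 K) K))) i = algebraMap K (AdeleRing (𝓞 K) K) ((ξ ᵥ* (γ : Matrix (Fin 2) (Fin 2) K)) i)
  rw [RingHom.map_vecMul]

/-- `e₂ g` has finite height data for every `g ∈ GL₂(𝔸_K)`. [folklore] -/
theorem isHeightFinite_single_one_vecMul (g : GL (Fin 2) (AdeleRing (𝓞 K) K)) :
    IsHeightFinite K (Pi.single (1 : Fin 2) (1 : AdeleRing (𝓞 K) K) ᵥ*
      (g : Matrix (Fin 2) (Fin 2) (AdeleRing (𝓞 K) K))) := by
  classical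
  rw [← principalVec_single_one]
  exact isHeightFinite_principalVec_vecMul (by simp) g

/-! ### Invariance properties -/

omit [NumberField K] in
/-- The `(1,0)` and `(1,1)` entries of the inverse of a rational Borel element. [folklore] -/
theorem borel_inv_entries {b : GL (Fin 2) K} (hb : b ∈ standardParabolicGL K (id : Fin 2 → Fin 2)) :
    ((b⁻¹ : GL (Fin 2) K) : Matrix (Fin 2) (Fin 2) K) 1 0 = 0 ∧
      ((b⁻¹ : GL (Fin 2) K) : Matrix (Fin 2) (Fin 2) K) 1 1 ≠ 0 := by
  have h10 : ((b⁻¹ : GL (Fin 2) K) : Matrix (Fin 2) (Fin 2) K) 1 0 = 0 :=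
    (GL2.mem_borel_iff (b⁻¹)).1 (inv_mem hb)
  refine ⟨h10, fun h0 => ?_⟩
  have hdet : Matrix.det ((b⁻¹ : GL (Fin 2) K) : Matrix (Fin 2) (Fin 2) K) = 0 := by
    rw [Matrix.det_fin_two, h10, h0, mul_zero, mul_zero, sub_zero]
  have hne := (Matrix.GeneralLinearGroup.det (b⁻¹)).ne_zero
  rw [Matrix.GeneralLinearGroup.val_det_apply] at hne
  exact hne hdet

/-- **Right invariance under the rational Borel subgroup**: `𝔥(y ι(b)) = 𝔥(y)` for `b ∈ B(K)`
(`e₂ b⁻¹ = (b⁻¹)₁₁ e₂` with `(b⁻¹)₁₁ ∈ Kˣ`; product formula for heights and for `det`).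
[folklore] -/
theorem cuspParamGL2_mul_map_of_mem_borel (y : GL (Fin 2) (AdeleRing (𝓞 K) K))
    {b : GL (Fin 2) K} (hb : b ∈ standardParabolicGL K (id : Fin 2 → Fin 2)) :
    cuspParamGL2 K (y * Matrix.GeneralLinearGroup.map (algebraMap K (AdeleRing (𝓞 K) K)) b) =
      cuspParamGL2 K y := by
  obtain ⟨h10, h11⟩ := borel_inv_entries K hb
  set κ : Kˣ := Units.mk0 _ h11 with hκ
  have hinv : ((y * Matrix.GeneralLinearGroup.map (algebraMap K (AdeleRing (𝓞 K) K)) b)⁻¹ :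
      GL (Fin 2) (AdeleRing (𝓞 K) K)) =
      Matrix.GeneralLinearGroup.map (algebraMap K (AdeleRing (𝓞 K) K)) b⁻¹ * y⁻¹ := by
    rw [mul_inv_rev, map_inv]
  have hrow : Pi.single (1 : Fin 2) (1 : AdeleRing (𝓞 K) K) ᵥ*
      ((Matrix.GeneralLinearGroup.map (algebraMap K (AdeleRing (𝓞 K) K)) b⁻¹ :
        GL (Fin 2) (AdeleRing (𝓞 K) K)) : Matrix (Fin 2) (Fin 2) (AdeleRing (𝓞 K) K)) =
      algebraMap K (AdeleRing (𝓞 K) K) κ • Pi.single (1 : Fin 2) (1 : AdeleRing (𝓞 K) K) := by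
    have h10' : ((Matrix.GeneralLinearGroup.map (algebraMap K (AdeleRing (𝓞 K) K)) b⁻¹ :
        GL (Fin 2) (AdeleRing (𝓞 K) K)) : Matrix (Fin 2) (Fin 2) (AdeleRing (𝓞 K) K)) 1 0 = 0 := by
      change algebraMap K (AdeleRing (𝓞 K) K) (((b⁻¹ : GL (Fin 2) K) : Matrix (Fin 2) (Fin 2) K) 1 0) = 0
      rw [h10, map_zero]
    rw [single_one_vecMul_of_apply_one_zero h10', ← Pi.single_smul', smul_eq_mul, mul_one]
    rfl
  rw [cuspParamGL2_apply, cuspParamGL2_apply, hinv, Units.val_mul, ← Matrix.vecMul_vecMul, hrow,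
    Matrix.smul_vecMul, vecHeight_smul_algebraMap (isHeightFinite_single_one_vecMul K y⁻¹) κ,
    map_mul, map_mul]
  have h1 : IdeleClassGroup.ideleNorm K (Matrix.GeneralLinearGroup.det
      (Matrix.GeneralLinearGroup.map (algebraMap K (AdeleRing (𝓞 K) K)) b⁻¹)) = 1 :=
    ideleNorm_det_toAdelic (n := 2) K b⁻¹
  rw [h1, one_mul]

/-- **Right invariance under `A_G`**: `𝔥(y z(t)) = 𝔥(y)` for the positive real scalar `z(t)`
(`h(t⁻¹ x) = t^{-d} h(x)`, `|det z(t)⁻¹| = t^{-2d}`, `d = [K:ℚ]`). [folklore] -/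
theorem cuspParamGL2_mul_posRealScalar (y : GL (Fin 2) (AdeleRing (𝓞 K) K)) (t : ℝ≥0ˣ) :
    cuspParamGL2 K (y * posRealScalar 2 K t) = cuspParamGL2 K y := by
  have hinv : ((y * posRealScalar 2 K t)⁻¹ : GL (Fin 2) (AdeleRing (𝓞 K) K)) =
      y⁻¹ * posRealScalar 2 K t⁻¹ := by
    rw [mul_inv_rev, ← map_inv]
    exact (Subgroup.mem_center_iff.1 (posRealScalar_mem_center 2 K t⁻¹) y⁻¹).symm
  have hrow : ∀ v : Fin 2 → AdeleRing (𝓞 K) K,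
      v ᵥ* ((posRealScalar 2 K t⁻¹ : GL (Fin 2) (AdeleRing (𝓞 K) K)) :
        Matrix (Fin 2) (Fin 2) (AdeleRing (𝓞 K) K)) =
      ((posRealIdele K t⁻¹ : (AdeleRing (𝓞 K) K)ˣ) : AdeleRing (𝓞 K) K) • v := by
    intro v
    change v ᵥ* ((Matrix.GeneralLinearGroup.scalar (Fin 2) (posRealIdele K t⁻¹) :
      GL (Fin 2) (AdeleRing (𝓞 K) K)) : Matrix (Fin 2) (Fin 2) (AdeleRing (𝓞 K) K)) = _
    rw [Matrix.GeneralLinearGroup.coe_scalar, Matrix.scalar_apply]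
    funext i
    rw [Matrix.vecMul_diagonal, Pi.smul_apply, smul_eq_mul, mul_comm]
  have hdet : IdeleClassGroup.ideleNorm K (Matrix.GeneralLinearGroup.det
      ((y * posRealScalar 2 K t)⁻¹ : GL (Fin 2) (AdeleRing (𝓞 K) K))) =
      ((t⁻¹ : ℝ≥0ˣ) : ℝ≥0) ^ (2 * Module.finrank ℚ K) *
        IdeleClassGroup.ideleNorm K (Matrix.GeneralLinearGroup.det y⁻¹) := by
    rw [hinv, map_mul, map_mul, ideleNorm_det_posRealScalar, mul_comm]
  rw [cuspParamGL2_apply, cuspParamGL2_apply, hdet, hinv, Units.val_mul, ← Matrix.vecMul_vecMul,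
    hrow, vecHeight_smul (isHeightFinite_single_one_vecMul K y⁻¹), ideleNorm_posRealIdele_holds K t⁻¹,
    mul_pow, ← pow_mul, mul_comm (Module.finrank ℚ K) 2]
  exact mul_div_mul_left _ _ (pow_ne_zero _ (t⁻¹).ne_zero)

/-- **Left invariance under `K`**: `𝔥(k y) = 𝔥(y)` for `k ∈ K = K_∞ GL₂(𝒪̂)` (heights and
`|det|` are `K`-invariant). [folklore] -/
theorem cuspParamGL2_compact_mul {k : GL (Fin 2) (AdeleRing (𝓞 K) K)}
    (hk : k ∈ standardMaximalCompactGL 2 K) (y : GL (Fin 2) (AdeleRing (𝓞 K) K)) :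
    cuspParamGL2 K (k * y) = cuspParamGL2 K y := by
  rw [cuspParamGL2_apply, cuspParamGL2_apply, mul_inv_rev, Units.val_mul, ← Matrix.vecMul_vecMul,
    vecHeight_vecMul_of_mem_standardMaximalCompactGL (inv_mem hk), map_mul, map_mul,
    ideleNorm_det_eq_one_of_isCompact (isCompact_standardMaximalCompactGL 2 K) (inv_mem hk), mul_one]

/-! ### The cusp parameter in Iwasawa coordinates `K · A · N` -/

/-- `e₂ u = e₂` for `u ∈ N₂`. [folklore] -/
theorem single_one_vecMul_of_mem_upperUnitriangular {R : Type*} [CommRing R] {u : GL (Fin 2) R}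
    (hu : u ∈ upperUnitriangular (Fin 2) R) :
    Pi.single (1 : Fin 2) (1 : R) ᵥ* (u : Matrix (Fin 2) (Fin 2) R) = Pi.single (1 : Fin 2) (1 : R) := by
  obtain ⟨htri, hdiag⟩ := (mem_upperUnitriangular_iff u).1 hu
  rw [single_one_vecMul_of_apply_one_zero (htri (show (id 0 : Fin 2) < id 1 by decide)), hdiag]

/-- `det d(a₁, a₂) = a₁ a₂`. [folklore] -/
theorem det_diagGL2 {R : Type*} [CommRing R] (a b : Rˣ) :
    Matrix.GeneralLinearGroup.det (diagGL2 a b) = a * b := by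
  apply Units.ext
  rw [Matrix.GeneralLinearGroup.val_det_apply, coe_diagGL2, Matrix.det_fin_two_of, Units.val_mul]
  ring

/-- **`𝔥(k d(a₁,a₂) u) = |a₁/a₂|_𝔸`** in the Iwasawa coordinates `K · A · N`
(`(k d u)⁻¹ = u⁻¹ d⁻¹ k⁻¹`, `e₂ u⁻¹ = e₂`, `e₂ d⁻¹ = a₂⁻¹ e₂`, `K`-invariance; Gelbart (8.9)).
[cite: Gelbart1975, (8.9)] -/
theorem cuspParamGL2_kan {k : GL (Fin 2) (AdeleRing (𝓞 K) K)} (hk : k ∈ standardMaximalCompactGL 2 K)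
    (a₁ a₂ : (AdeleRing (𝓞 K) K)ˣ) (u : ↥(adelicUnipotent 2 K)) :
    cuspParamGL2 K (k * diagGL2 a₁ a₂ * (u : GL (Fin 2) (AdeleRing (𝓞 K) K))) =
      IdeleClassGroup.ideleNorm K (a₁ * a₂⁻¹) := by
  classical
  rw [mul_assoc, cuspParamGL2_compact_mul K hk, cuspParamGL2_apply, mul_inv_rev, Units.val_mul,
    ← Matrix.vecMul_vecMul, single_one_vecMul_of_mem_upperUnitriangular (inv_mem u.2), diagGL2_inv]
  have hrow : Pi.single (1 : Fin 2) (1 : AdeleRing (𝓞 K) K) ᵥ*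
      ((diagGL2 a₁⁻¹ a₂⁻¹ : GL (Fin 2) (AdeleRing (𝓞 K) K)) : Matrix (Fin 2) (Fin 2) (AdeleRing (𝓞 K) K)) =
      Pi.single (1 : Fin 2) (((a₂⁻¹ : (AdeleRing (𝓞 K) K)ˣ) : AdeleRing (𝓞 K) K)) := by
    rw [single_one_vecMul_of_apply_one_zero (by rw [coe_diagGL2]; rfl), coe_diagGL2]
    rfl
  have hdet : Matrix.GeneralLinearGroup.det (((u : GL (Fin 2) (AdeleRing (𝓞 K) K)))⁻¹ *
      diagGL2 a₁⁻¹ a₂⁻¹) = a₁⁻¹ * a₂⁻¹ := by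
    rw [map_mul, map_inv, det_eq_one_of_mem_upperUnitriangular u.2, inv_one, one_mul, det_diagGL2]
  rw [hdet, hrow, vecHeight_single]
  simp only [map_mul, map_inv]
  have h1 := ideleNorm_ne_zero (K := K) a₁
  have h2 := ideleNorm_ne_zero (K := K) a₂
  field_simp

/-! ### Lemma 9.8: separation of cusps -/

/-- **Lemma 9.8 (sharp form, right-quotient conventions)**: for `γ ∈ GL₂(K) ∖ B(K)` and every
`y ∈ GL₂(𝔸_K)`, `1 ≤ 𝔥(y ι(γ)) · 𝔥(y)` — Gelbart's `H(γ x) + H(x) ≤ 0` with `c₁ = 1`: if `y` is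
in the cusp `{𝔥 < 1}` then `y ι(γ)` is not. From the Hadamard inequality
`|det g|_𝔸 ≤ h((e₂γ⁻¹) g) h(e₂ g)` (`GL2CuspSeparation`) with `g = y⁻¹`.
[cite: Gelbart1975, Lemma 9.8] -/
theorem one_le_cuspParamGL2_mul_map_mul (y : GL (Fin 2) (AdeleRing (𝓞 K) K)) {γ : GL (Fin 2) K}
    (hγ : γ ∉ standardParabolicGL K (id : Fin 2 → Fin 2)) :
    1 ≤ cuspParamGL2 K (y * Matrix.GeneralLinearGroup.map (algebraMap K (AdeleRing (𝓞 K) K)) γ) *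
      cuspParamGL2 K y := by
  classical
  set g : GL (Fin 2) (AdeleRing (𝓞 K) K) := y⁻¹ with hg
  set ξ : Fin 2 → K := Pi.single (1 : Fin 2) (1 : K) ᵥ* ((γ⁻¹ : GL (Fin 2) K) : Matrix (Fin 2) (Fin 2) K)
    with hξ
  -- `ξ = e₂ γ⁻¹` and `e₂` are independent since `γ⁻¹ ∉ B`
  have hind : ξ 0 * (Pi.single (1 : Fin 2) (1 : K) : Fin 2 → K) 1 -
      ξ 1 * (Pi.single (1 : Fin 2) (1 : K) : Fin 2 → K) 0 ≠ 0 := by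
    have hγ' : γ⁻¹ ∉ standardParabolicGL K (id : Fin 2 → Fin 2) := fun h => hγ (by simpa using inv_mem h)
    rw [GL2.mem_borel_iff] at hγ'
    have hξ0 : ξ 0 = ((γ⁻¹ : GL (Fin 2) K) : Matrix (Fin 2) (Fin 2) K) 1 0 := by
      rw [hξ, Matrix.single_one_vecMul, Matrix.row_apply]
    simpa [hξ0] using hγ'
  have H := ideleNorm_det_le_vecHeight_vecMul_mul K g hind
  -- identify the two rows
  have hinv : ((y * Matrix.GeneralLinearGroup.map (algebraMap K (AdeleRing (𝓞 K) K)) γ)⁻¹ :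
      GL (Fin 2) (AdeleRing (𝓞 K) K)) =
      Matrix.GeneralLinearGroup.map (algebraMap K (AdeleRing (𝓞 K) K)) γ⁻¹ * g := by
    rw [mul_inv_rev, map_inv]
  have hrow1 : Pi.single (1 : Fin 2) (1 : AdeleRing (𝓞 K) K) ᵥ*
      (((y * Matrix.GeneralLinearGroup.map (algebraMap K (AdeleRing (𝓞 K) K)) γ)⁻¹ :
        GL (Fin 2) (AdeleRing (𝓞 K) K)) : Matrix (Fin 2) (Fin 2) (AdeleRing (𝓞 K) K)) =
      principalVec K ξ ᵥ* (g : Matrix (Fin 2) (Fin 2) (AdeleRing (𝓞 K) K)) := by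
    rw [hinv, Units.val_mul, ← Matrix.vecMul_vecMul, ← principalVec_single_one,
      principalVec_vecMul_map_two]
  have hrow2 : Pi.single (1 : Fin 2) (1 : AdeleRing (𝓞 K) K) ᵥ* (g : Matrix (Fin 2) (Fin 2) (AdeleRing (𝓞 K) K)) =
      principalVec K (Pi.single (1 : Fin 2) (1 : K)) ᵥ* (g : Matrix (Fin 2) (Fin 2) (AdeleRing (𝓞 K) K)) := by
    rw [principalVec_single_one]
  have hdet : IdeleClassGroup.ideleNorm K (Matrix.GeneralLinearGroup.det
      ((y * Matrix.GeneralLinearGroup.map (algebraMap K (AdeleRing (𝓞 K) K)) γ)⁻¹ :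
        GL (Fin 2) (AdeleRing (𝓞 K) K))) =
      IdeleClassGroup.ideleNorm K (Matrix.GeneralLinearGroup.det g) := by
    rw [hinv, map_mul, map_mul]
    have h1 : IdeleClassGroup.ideleNorm K (Matrix.GeneralLinearGroup.det
        (Matrix.GeneralLinearGroup.map (algebraMap K (AdeleRing (𝓞 K) K)) γ⁻¹)) = 1 :=
      ideleNorm_det_toAdelic (n := 2) K γ⁻¹
    rw [h1, one_mul]
  rw [cuspParamGL2_apply, cuspParamGL2_apply, hrow1, hdet, ← hg, hrow2]
  set N := IdeleClassGroup.ideleNorm K (Matrix.GeneralLinearGroup.det g) with hN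
  set A := vecHeight K (principalVec K ξ ᵥ* (g : Matrix (Fin 2) (Fin 2) (AdeleRing (𝓞 K) K))) with hA
  set B := vecHeight K (principalVec K (Pi.single (1 : Fin 2) (1 : K)) ᵥ*
    (g : Matrix (Fin 2) (Fin 2) (AdeleRing (𝓞 K) K))) with hB
  have hN0 : N ≠ 0 := ideleNorm_ne_zero _
  rw [div_mul_div_comm, ← mul_pow, ← pow_two, ← div_pow]
  refine one_le_pow₀ ?_
  rw [one_le_div₀ (pos_iff_ne_zero.2 hN0)]
  exact H

end Literature.NumberTheory.Automorphic
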